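import Summits.QuantumFields.YangMills.Theorems.LuscherReductionTwistedTraceScalingTrialStateStep
import Summits.QuantumFields.YangMills.Theorems.LuscherReductionTwistedTraceScalingStepUpperModel
import Summits.QuantumFields.YangMills.Theorems.LuscherReductionTwistedTraceScalingHarmonicStepIntegral
import HarnessLib

/-!
# POINTWISE SUPER-SOLUTION BOUND for the covariant stiff Gaussian trial state at a small-action configuration
# (covariant programme, brick c4(iii) assembled — upper direction, pure stiff Gaussian, measurability as a hypothesis)

Cell `ym-fleet`, crux `TwistedTraceScaling` (stmt-QuantumFields-20203), line «twolattice», stub S-BASE, lane B = COARSE-LOWER(L₁)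
(design note `pub/ym-fleet/ym-20203-coarse-s1/LOWER-BLUEPRINT.md` §5–§6; Schur door `Lower.levelValue_zero_le_of_supersolution`).  HONEST FRAMING:
fixed-lattice bookkeeping; the cut-off `χ(S ≤ σ)`, the zero-mode factor `F₀`, the valley and the large field are NOT here; a stub of a child of the
CONDITIONAL reduction route (femto rung R2b1); not a gap, not Clay.

With `H(V) = stiffTrial g V = exp(−q_{D_V}(F(V)))` (`q` the canonical weight of `…SpectralWeight`, `g` any weight function with `0 ≤ g ≤ m`,
`g(s)s ≤ m₁`, `|g s − g t| ≤ L|s − t|`), for `β > 0`, `δ < 1`, `0 ≤ ρ ≤ 1/100`, `(1−δ)⁻² − 1 ≤ ρ²`, `σ ≤ 1/16`, `S(U) ≤ σ`, and ASSUMING `H` measurable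
(continuity of `U ↦ q_{D_U}(F(U))` via Mathlib `continuousOn_cfc` is brick (m5), not yet filed):

* `stiffTrial`, `stiffTrial_pos`, `stiffTrial_le_one`; `modelU` (the all-space model integrand at `U`), `integrable_modelU`;
* `integral_upperModel_stiffTrial_le` — `∫ upperModel ≤ e^{E} ∫ modelU` (`E = trialErr`, `…TrialStateStep`);
* ★★★ `transferApply_stiffTrial_le` —
  `(K_β H)(U) ≤ (2π²)^{−|E|} e^{2β|E|} e^{(β/2)(η₁+θ)} e^{E} · (Πᵢ √(π/(tλᵢ + b' + g(λᵢ)λᵢ²)) e^{−κᵢ(φᵢ/λᵢ)²}) · H(U) + e^{2β|E|} e^{−2βδ}`,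
  `t = β/2`, `b' = β(1+ρ²)⁻²`, `(λᵢ, eᵢ)` the Gram eigenframe of `D_U`, `φᵢ = ⟨D_U eᵢ, F(U)⟩`, `κᵢ = Harm.stepGain λᵢ t b' (g λᵢ)` — the defect
  factor and the potential cancel against `e^{−(β/2)S(U)}` (`‖F‖² ≤ S`, Bessel).  For a weight below the `b'`-Riccati envelope every `κᵢ ≥ 0` and the
  product is `≤ Πᵢ √(π/s'ᵢ) =: Λ_g(U)`.

## References
* M. Lüscher, Nucl. Phys. B219 (1983) 233, §3. [Luscher1983]
* A. Wipf, LNP 992 (2021), §8.5. [Wipf2021]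
-/

noncomputable section

open MeasureTheory Real
open scoped RealInnerProductSpace
open Literature.MathematicalPhysics.QuantumFieldTheory
open Literature.MathematicalPhysics.QuantumLattice

namespace Summit.QuantumFields.YangMills.Theorems.FemtoTransferGap.TwoLattice.Cov

open Summit.QuantumFields.YangMills.Theorems.FemtoTransferGap
open Summit.QuantumFields.YangMills.Theorems.FemtoTransferGap.TwoLattice
open Summit.QuantumFields.YangMills.Theorems.FemtoTransferGap.TwoLattice.Stiff
open Summit.QuantumFields.YangMills.Theorems.FemtoTransferGap.TwoLattice.GnChart
open Summit.QuantumFields.YangMills.Theorems.FemtoTransferGap.TwoLattice.Harm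

variable {L : ℕ} [NeZero L]

/-! ## §1 The covariant stiff Gaussian trial state -/

/-- The covariant stiff Gaussian trial state `H(V) = exp(−q_{D_V}(F(V)))`. [cite: Luscher1983, §3] -/
def stiffTrial (g : ℝ → ℝ) (V : GaugeConfig 3 L SU2) : ℝ := Real.exp (-weightForm g (covCurl V) (plaqCurv V))

/-- `H > 0`. [folklore] -/
theorem stiffTrial_pos (g : ℝ → ℝ) (V : GaugeConfig 3 L SU2) : 0 < stiffTrial g V := Real.exp_pos _

/-- `H ≤ 1` for `g ≥ 0`. [folklore] -/
theorem stiffTrial_le_one {g : ℝ → ℝ} (hg0 : ∀ s, 0 ≤ g s) (V : GaugeConfig 3 L SU2) : stiffTrial g V ≤ 1 := by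
  unfold stiffTrial
  rw [Real.exp_le_one_iff, neg_nonpos]
  exact weightForm_nonneg hg0 _ _

/-! ## §2 The all-space model integrand at `U` -/

/-- Continuity of the model exponent in the step variable (fixed `U`). [folklore] -/
theorem continuous_weightForm_step (g : ℝ → ℝ) (U : GaugeConfig 3 L SU2) :
    Continuous fun x : LinkSpace L => weightForm g (covCurl U) (plaqCurv U + covCurl U x) := by
  unfold weightForm
  have h1 : Continuous fun x : LinkSpace L => (covCurl U).adjoint (plaqCurv U + covCurl U x) :=
    (covCurl U).adjoint.continuous_of_finiteDimensional.comp (continuous_const.add (covCurl U).continuous_of_finiteDimensional)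
  exact h1.inner ((spectralWeightLin g (covCurl U)).continuous_of_finiteDimensional.comp h1)

/-- The model integrand at `U` on all of the link space: `e^{−b'‖x‖²} e^{−t‖F + D_U x‖²} e^{−q_{D_U}(F + D_U x)}`, `b' = β(1+ρ²)⁻²`, `t = β/2`.
[cite: Wipf2021, §8.5.2] -/
def modelU (β ρ : ℝ) (g : ℝ → ℝ) (U : GaugeConfig 3 L SU2) (x : LinkSpace L) : ℝ :=
  Real.exp (-(β / (1 + ρ ^ 2) ^ 2 * ‖x‖ ^ 2)) * Real.exp (-(β / 2 * ‖plaqCurv U + covCurl U x‖ ^ 2)) *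
    Real.exp (-weightForm g (covCurl U) (plaqCurv U + covCurl U x))

/-- The model integrand is integrable (`β > 0`, `g ≥ 0`). [folklore] -/
theorem integrable_modelU {β ρ : ℝ} (hβ : 0 < β) {g : ℝ → ℝ} (hg0 : ∀ s, 0 ≤ g s) (U : GaugeConfig 3 L SU2) :
    Integrable (modelU β ρ g U) := by
  have hb : 0 < β / (1 + ρ ^ 2) ^ 2 := by positivity
  have hm : Measurable (modelU β ρ g U) := by
    unfold modelU
    have hc : Continuous fun x : LinkSpace L => ‖plaqCurv U + covCurl U x‖ ^ 2 :=
      (continuous_const.add (covCurl U).continuous_of_finiteDimensional).norm.pow 2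
    refine ((by fun_prop : Measurable fun x : LinkSpace L => Real.exp (-(β / (1 + ρ ^ 2) ^ 2 * ‖x‖ ^ 2))).mul
      (continuous_exp.comp (continuous_const.mul hc).neg).measurable).mul
      (continuous_exp.comp (continuous_weightForm_step g U).neg).measurable
  refine Integrable.mono' (integrable_rexp_neg_mul_sq_norm (V := LinkSpace L) hb) hm.aestronglyMeasurable (ae_of_all _ fun x => ?_)
  rw [Real.norm_eq_abs, modelU, abs_of_nonneg (by positivity), neg_mul]
  have h1 : Real.exp (-(β / 2 * ‖plaqCurv U + covCurl U x‖ ^ 2)) ≤ 1 := by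
    rw [Real.exp_le_one_iff, neg_nonpos]; positivity
  have h2 : Real.exp (-weightForm g (covCurl U) (plaqCurv U + covCurl U x)) ≤ 1 := by
    rw [Real.exp_le_one_iff, neg_nonpos]; exact weightForm_nonneg hg0 _ _
  calc _ ≤ Real.exp (-(β / (1 + ρ ^ 2) ^ 2 * ‖x‖ ^ 2)) * 1 * 1 :=
        mul_le_mul (mul_le_mul_of_nonneg_left h1 (Real.exp_pos _).le) h2 (Real.exp_pos _).le (by positivity)
    _ = _ := by ring

/-- ★ The UPPER model integrand against the stiff trial state is dominated by `e^{E}` times the all-space model integrand (`E = trialErr`).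
[cite: Luscher1983, §3] -/
theorem upperModel_stiffTrial_le {β ρ σ : ℝ} {g : ℝ → ℝ} {m m₁ Lg : ℝ} (hg0 : ∀ s, 0 ≤ g s) (hgm : ∀ s, g s ≤ m)
    (hgm₁ : ∀ s, 0 ≤ s → g s * s ≤ m₁) (hL : 0 ≤ Lg) (hLip : ∀ s t, |g s - g t| ≤ Lg * |s - t|) (hρ0 : 0 ≤ ρ) (hρ : ρ ≤ 1 / 30)
    (hσ : σ ≤ 1 / 16) (U : GaugeConfig 3 L SU2) (hS : wilsonAction su2Rep U ≤ σ) (x : LinkSpace L) :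
    upperModel β ρ (stiffTrial g) U x ≤
      Real.exp (trialErr ρ σ (Fintype.card (Plaquette 3 L × Fin 3)) (Fintype.card (Edge 3 L × Fin 3)) m m₁ Lg) * modelU β ρ g U x := by
  unfold upperModel
  by_cases hx : x ∈ chartBall L ρ
  · rw [Set.indicator_of_mem hx]
    have hy : ∀ e, ∑ a, linkCurry x e a ^ 2 ≤ ρ ^ 2 := hx
    have h := exp_neg_weightForm_step_le U (linkCurry x) hg0 hgm hgm₁ hL hLip hρ0 hρ hσ hS hy
    rw [chartVec_linkCurry] at h
    unfold stiffTrial modelU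
    rw [neg_mul]
    calc Real.exp (-(β / (1 + ρ ^ 2) ^ 2 * ‖x‖ ^ 2)) * Real.exp (-(β / 2 * ‖plaqCurv U + covCurl U x‖ ^ 2)) *
          Real.exp (-weightForm g (covCurl (latPatternChart L (fun _ => false) (linkCurry x) * U))
            (plaqCurv (latPatternChart L (fun _ => false) (linkCurry x) * U)))
        ≤ Real.exp (-(β / (1 + ρ ^ 2) ^ 2 * ‖x‖ ^ 2)) * Real.exp (-(β / 2 * ‖plaqCurv U + covCurl U x‖ ^ 2)) *
          (Real.exp (trialErr ρ σ (Fintype.card (Plaquette 3 L × Fin 3)) (Fintype.card (Edge 3 L × Fin 3)) m m₁ Lg) *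
            Real.exp (-weightForm g (covCurl U) (plaqCurv U + covCurl U x))) :=
          mul_le_mul_of_nonneg_left h (by positivity)
      _ = _ := by ring
  · rw [Set.indicator_of_notMem hx]
    unfold modelU; positivity

/-- `∫ upperModel ≤ e^{E} ∫ modelU`. [cite: Luscher1983, §3] -/
theorem integral_upperModel_stiffTrial_le {β ρ σ : ℝ} (hβ : 0 < β) {g : ℝ → ℝ} {m m₁ Lg : ℝ} (hg0 : ∀ s, 0 ≤ g s) (hgm : ∀ s, g s ≤ m)
    (hgm₁ : ∀ s, 0 ≤ s → g s * s ≤ m₁) (hL : 0 ≤ Lg) (hLip : ∀ s t, |g s - g t| ≤ Lg * |s - t|) (hρ0 : 0 ≤ ρ) (hρ : ρ ≤ 1 / 30)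
    (hσ : σ ≤ 1 / 16) (U : GaugeConfig 3 L SU2) (hS : wilsonAction su2Rep U ≤ σ) :
    ∫ x, upperModel β ρ (stiffTrial g) U x ≤
      Real.exp (trialErr ρ σ (Fintype.card (Plaquette 3 L × Fin 3)) (Fintype.card (Edge 3 L × Fin 3)) m m₁ Lg) * ∫ x, modelU β ρ g U x := by
  rw [← integral_const_mul]
  refine integral_mono_of_nonneg (ae_of_all _ fun x => ?_) ((integrable_modelU hβ hg0 U).const_mul _) (ae_of_all _ fun x =>
    upperModel_stiffTrial_le hg0 hgm hgm₁ hL hLip hρ0 hρ hσ U hS x)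
  show 0 ≤ upperModel β ρ (stiffTrial g) U x
  unfold upperModel
  by_cases hx : x ∈ chartBall L ρ
  · rw [Set.indicator_of_mem hx]; exact mul_nonneg (by positivity) (stiffTrial_pos g _).le
  · rw [Set.indicator_of_notMem hx]

/-! ## §3 The pointwise super-solution bound -/

/-- ★★★ **POINTWISE SUPER-SOLUTION BOUND FOR THE COVARIANT STIFF GAUSSIAN.**  See the module docstring. [cite: Luscher1983, §3] [cite: Wipf2021, §8.5.2] -/
theorem transferApply_stiffTrial_le {β δ ρ σ : ℝ} (hβ : 0 < β) (hδ : δ < 1) (hρ0 : 0 ≤ ρ) (hρ : ρ ≤ 1 / 100)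
    (hρδ : ((1 - δ) ^ 2)⁻¹ - 1 ≤ ρ ^ 2) (hσ : σ ≤ 1 / 16) {g : ℝ → ℝ} {m m₁ Lg : ℝ} (hg0 : ∀ s, 0 ≤ g s) (hgm : ∀ s, g s ≤ m)
    (hgm₁ : ∀ s, 0 ≤ s → g s * s ≤ m₁) (hL : 0 ≤ Lg) (hLip : ∀ s t, |g s - g t| ≤ Lg * |s - t|)
    (hH : Measurable (stiffTrial (L := L) g)) (U : GaugeConfig 3 L SU2) (hS : wilsonAction su2Rep U ≤ σ) :
    transferApply β (stiffTrial g) U ≤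
      ((2 * π ^ 2)⁻¹) ^ Fintype.card (Edge 3 L) * Real.exp (2 * β) ^ Fintype.card (Edge 3 L) *
          Real.exp (β / 2 * (stepErrLo ρ σ (Fintype.card (Plaquette 3 L × Fin 3)) + chartErr ρ σ (Fintype.card (Plaquette 3 L × Fin 3)))) *
          Real.exp (trialErr ρ σ (Fintype.card (Plaquette 3 L × Fin 3)) (Fintype.card (Edge 3 L × Fin 3)) m m₁ Lg) *
          (∏ i, Real.sqrt (π / (β / 2 * (gramMatrix_isHermitian (covCurl U)).eigenvalues i + β / (1 + ρ ^ 2) ^ 2 +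
              g ((gramMatrix_isHermitian (covCurl U)).eigenvalues i) * (gramMatrix_isHermitian (covCurl U)).eigenvalues i ^ 2)) *
            Real.exp (-(stepGain ((gramMatrix_isHermitian (covCurl U)).eigenvalues i) (β / 2) (β / (1 + ρ ^ 2) ^ 2)
              (g ((gramMatrix_isHermitian (covCurl U)).eigenvalues i)) *
              (⟪covCurl U ((gramMatrix_isHermitian (covCurl U)).eigenvectorBasis i), plaqCurv U⟫ /
                (gramMatrix_isHermitian (covCurl U)).eigenvalues i) ^ 2))) *
          stiffTrial g U +
        Real.exp (2 * β) ^ Fintype.card (Edge 3 L) * Real.exp (-(2 * β * δ)) := by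
  -- abbreviations
  set N : ℝ := (Fintype.card (Plaquette 3 L × Fin 3) : ℝ)
  set E := trialErr ρ σ N (Fintype.card (Edge 3 L × Fin 3)) m m₁ Lg
  set K₀ : ℝ := ((2 * π ^ 2)⁻¹) ^ Fintype.card (Edge 3 L) * Real.exp (2 * β) ^ Fintype.card (Edge 3 L) *
    Real.exp (β / 2 * (stepErrLo ρ σ N + chartErr ρ σ N)) with hK₀
  set lam := (gramMatrix_isHermitian (covCurl U)).eigenvalues
  set e := (gramMatrix_isHermitian (covCurl U)).eigenvectorBasis
  set φ : Edge 3 L × Fin 3 → ℝ := fun i => ⟪covCurl U (e i), plaqCurv U⟫ with hφ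
  set t : ℝ := β / 2 with ht
  set b' : ℝ := β / (1 + ρ ^ 2) ^ 2 with hb'
  have hK0 : 0 ≤ K₀ := by positivity
  have ht0 : 0 ≤ t := by positivity
  have hb0 : 0 < b' := by positivity
  -- step 1: near/far + model domination
  have h1 := transferApply_le_far_add_model hβ hδ hρ0 hρ hρδ hσ hH (fun V => (stiffTrial_pos g V).le) (C := 1)
    (fun V => stiffTrial_le_one hg0 V) U hS
  -- step 2: the upper model integral against the all-space model
  have h2 := integral_upperModel_stiffTrial_le hβ hg0 hgm hgm₁ hL hLip hρ0 (by linarith) hσ U hS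
  -- step 3: closed form
  have hD := gram_frame (covCurl U)
  have h3 : ∫ x, modelU β ρ g U x = Real.exp (-(t * ‖plaqCurv U‖ ^ 2)) *
      ∏ i, Real.sqrt (π / (t * lam i + b' + g (lam i) * lam i ^ 2)) * Real.exp (2 * t * φ i ^ 2 / lam i) *
        Real.exp (-(stepGain (lam i) t b' (g (lam i)) * (φ i / lam i) ^ 2)) * Real.exp (-(g (lam i) * φ i ^ 2)) := by
    have := integral_harmonicStep_weightForm (covCurl U) hg0 ht0 hb0 (plaqCurv U)
    simpa only [modelU, ht, hb'] using this
  -- step 4: product bookkeeping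
  set P₁ : ℝ := ∏ i, Real.sqrt (π / (t * lam i + b' + g (lam i) * lam i ^ 2)) *
    Real.exp (-(stepGain (lam i) t b' (g (lam i)) * (φ i / lam i) ^ 2)) with hP₁
  have hP₁0 : 0 ≤ P₁ := Finset.prod_nonneg fun i _ => by positivity
  have hprod : (∏ i, Real.sqrt (π / (t * lam i + b' + g (lam i) * lam i ^ 2)) * Real.exp (2 * t * φ i ^ 2 / lam i) *
        Real.exp (-(stepGain (lam i) t b' (g (lam i)) * (φ i / lam i) ^ 2)) * Real.exp (-(g (lam i) * φ i ^ 2))) =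
      P₁ * Real.exp (∑ i, 2 * t * φ i ^ 2 / lam i) * Real.exp (-(∑ i, g (lam i) * φ i ^ 2)) := by
    rw [hP₁, Real.exp_sum, ← Finset.sum_neg_distrib, Real.exp_sum, ← Finset.prod_mul_distrib, ← Finset.prod_mul_distrib]
    exact Finset.prod_congr rfl fun i _ => by ring
  have hH : stiffTrial g U = Real.exp (-(∑ i, g (lam i) * φ i ^ 2)) := by
    unfold stiffTrial; rw [weightForm_eq_sum g (covCurl U) hD (plaqCurv U)]
  -- step 5: the cancellation `e^{−(β/2)S} e^{−t‖F‖²} e^{2tΣφ²/λ} ≤ 1`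
  have hcancel : Real.exp (-(β / 2) * wilsonAction su2Rep U) * (Real.exp (-(t * ‖plaqCurv U‖ ^ 2)) *
      Real.exp (∑ i, 2 * t * φ i ^ 2 / lam i)) ≤ 1 := by
    rw [← Real.exp_add, ← Real.exp_add, Real.exp_le_one_iff]
    have hB : ∑ i, φ i ^ 2 / lam i ≤ ‖plaqCurv U‖ ^ 2 := sum_sq_div_le_norm_sq hD (plaqCurv U)
    have hS' : ‖plaqCurv U‖ ^ 2 ≤ wilsonAction su2Rep U := norm_plaqCurv_sq_le_wilsonAction U
    have e1 : ∑ i, 2 * t * φ i ^ 2 / lam i = 2 * t * ∑ i, φ i ^ 2 / lam i := by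
      rw [Finset.mul_sum]; exact Finset.sum_congr rfl fun i _ => by ring
    rw [e1, ht]
    nlinarith
  -- assemble
  calc transferApply β (stiffTrial g) U
      ≤ K₀ * Real.exp (-(β / 2) * wilsonAction su2Rep U) * (∫ x, upperModel β ρ (stiffTrial g) U x) +
          Real.exp (2 * β) ^ Fintype.card (Edge 3 L) * Real.exp (-(2 * β * δ)) * 1 := h1
    _ ≤ K₀ * Real.exp (-(β / 2) * wilsonAction su2Rep U) * (Real.exp E * ∫ x, modelU β ρ g U x) +
          Real.exp (2 * β) ^ Fintype.card (Edge 3 L) * Real.exp (-(2 * β * δ)) * 1 :=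
        add_le_add (mul_le_mul_of_nonneg_left h2 (by positivity)) le_rfl
    _ = K₀ * Real.exp E * P₁ * stiffTrial g U *
          (Real.exp (-(β / 2) * wilsonAction su2Rep U) * (Real.exp (-(t * ‖plaqCurv U‖ ^ 2)) * Real.exp (∑ i, 2 * t * φ i ^ 2 / lam i))) +
          Real.exp (2 * β) ^ Fintype.card (Edge 3 L) * Real.exp (-(2 * β * δ)) * 1 := by
        rw [h3, hprod, hH]; ring
    _ ≤ K₀ * Real.exp E * P₁ * stiffTrial g U * 1 + Real.exp (2 * β) ^ Fintype.card (Edge 3 L) * Real.exp (-(2 * β * δ)) * 1 :=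
        add_le_add (mul_le_mul_of_nonneg_left hcancel
          (mul_nonneg (mul_nonneg (mul_nonneg hK0 (Real.exp_pos E).le) hP₁0) (stiffTrial_pos g U).le)) le_rfl
    _ = _ := by rw [hK₀, hP₁, mul_one, mul_one]

end Summit.QuantumFields.YangMills.Theorems.FemtoTransferGap.TwoLattice.Cov

end
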